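import Summits.Ventures.AbcSig.Recipes.KrausDischarge

/-!
# Venture AbcSig — discharge of a per-orbit exclusion by CLASS-BY-CLASS Kraus tables (module M4 for multi-class families)

HONEST FRAMING. Glue file of the COMPUTATION cell `pub-abcsig`; no Diophantine statement, no claim on ABC or any summit, no new
named hypothesis. `Recipes/KrausDischarge.lean` proves the one-table case: if the WHOLE family `fam` (one exponent `n₀`) satisfies
`RefinedTraces fam A` for ONE table `A` and the extended orbit data are eliminated against `A`, the orbit is excluded for `fam`. The
cell's module M4 for the census families is CLASS-BY-CLASS (p1 certificates `census/rows/C2a/M4/M4p1_*.json`, engine-2 agreeing: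
"CLOSED = every class (both distributions, every a of the cell, every j = m mod n) is contradicted at some q"): the possible traces
`a_q(E) (mod n)` of the Frey curves depend on the class of the datum (distribution of `A·B`, residue of `m` mod `n`), each class has its
OWN table (computable: `Recipes/KrausTable.lean`, `krausTable μ A B C n q`), and an orbit is excluded for the family iff it is
eliminated in every class — possibly at a different auxiliary prime per class. THIS FILE proves exactly that composition:

* `NewformModel.excludes_union` — exclusions for two sub-families give the exclusion for their union (bookkeeping).
* `NewformModel.excludes_of_classTables` — if every datum of `fam` has exponent `n₀` and falls in one of finitely many classes
  `κ ∈ classes` (via `classOf`), each class carries the named hypothesis `RefinedTraces (fam ∩ class κ) (tab κ)` (CITED recipe +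
  COMPUTED table, as in `Rows/TemplateKraus.lean`) and extended orbit data `X κ` (same `F`, refining the tree data `o`, well-formed
  entries) ELIMINATED against `tab κ` at `n₀` (kernel certificate), then `M.Excludes N o fam` — the hypothesis shape `hX_…` of the
  rows, now provable per orbit from one table hypothesis PER CLASS instead of a citation per (orbit, n) pair.

Intended use (successor generator, HOME/plean/g7/README-g7.md): for each C2a pair closed by M4 in a row of record, emit the class
tables (`S_q_mod_n` of the certificate = `krausTableMod …` of `Recipes/KrausTable.lean`), the extended data at the classes' auxiliary
primes (Sturm-complete level files) with `decide +kernel` certificates, and replace the row's cited `hX_…` by this theorem.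

References: A. Kraus, Canad. J. Math. 49 (1997) 1139–1161; [BS04] Prop. 4.3, Lemma 4.2; cell records census/rows/*/M4/, HOME/referee/refallowed.py.
-/

namespace Summit.Ventures.AbcSig

/-- Exclusion for a union of two sub-families from the exclusions for each. -/
theorem NewformModel.excludes_union (M : NewformModel) (N : ℕ) (o : OrbitData) (fam₁ fam₂ : FreyDatum → Prop)
    (h₁ : M.Excludes N o fam₁) (h₂ : M.Excludes N o fam₂) : M.Excludes N o (fun S => fam₁ S ∨ fam₂ S) := by
  intro S hS f hfo
  rcases hS with hS | hS
  · exact h₁ S hS f hfo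
  · exact h₂ S hS f hfo

/-- Exclusion is antitone in the family. -/
theorem NewformModel.excludes_mono (M : NewformModel) (N : ℕ) (o : OrbitData) {fam fam' : FreyDatum → Prop}
    (hsub : ∀ S, fam' S → fam S) (h : M.Excludes N o fam) : M.Excludes N o fam' :=
  fun S hS f hfo => h S (hsub S hS) f hfo

/-- **Class-by-class Kraus discharge of a per-orbit exclusion.** See the module docstring. `κ` indexes the classes (any type),
`classOf S` is the class of a datum, `tab κ` the class's table, `X κ` the extended orbit data used for that class. -/
theorem NewformModel.excludes_of_classTables (M : NewformModel) {N : ℕ} {ι : Type} (o : OrbitData)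
    (fam : FreyDatum → Prop) (n₀ : ℕ) (classes : List ι) (classOf : FreyDatum → ι) (tab : ι → ℕ → List ℤ)
    (X : ι → OrbitData)
    (hfam : ∀ S, fam S → S.n = n₀ ∧ classOf S ∈ classes)
    (hRT : ∀ κ ∈ classes, M.RefinedTraces (fun S => fam S ∧ classOf S = κ) (tab κ))
    (hF : ∀ κ ∈ classes, (X κ).F = o.F)
    (hRef : ∀ κ ∈ classes, M.Refines N o (X κ))
    (helim : ∀ κ ∈ classes, (X κ).Eliminated (tab κ) n₀)
    (hgood : ∀ κ ∈ classes, ∀ e ∈ (X κ).coeffs, e.ell.Prime ∧ e.ell ≠ 2 ∧ ¬ e.ell ∣ N) :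
    M.Excludes N o fam := by
  intro S hS f hfo harises
  obtain ⟨-, hκ⟩ := hfam S hS
  have hsub : M.Excludes N o (fun S' => fam S' ∧ classOf S' = classOf S) :=
    M.excludes_of_refinedTraces o (X (classOf S)) (hF _ hκ) (hRef _ hκ) _ n₀ (tab (classOf S)) (hRT _ hκ)
      (fun S' hS' => (hfam S' hS'.1).1) (helim _ hκ) (hgood _ hκ)
  exact hsub S ⟨hS, rfl⟩ f hfo harises

/-- The same with the class data packaged as ONE extended datum per class and a shared well-formedness check — the shape a
generator emits: a list of `(class, table, extended data)` triples. -/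
theorem NewformModel.excludes_of_classList (M : NewformModel) {N : ℕ} {ι : Type} (o : OrbitData)
    (fam : FreyDatum → Prop) (n₀ : ℕ) (classOf : FreyDatum → ι) (data : List (ι × (ℕ → List ℤ) × OrbitData))
    (hfam : ∀ S, fam S → S.n = n₀ ∧ ∃ d ∈ data, d.1 = classOf S)
    (hRT : ∀ d ∈ data, M.RefinedTraces (fun S => fam S ∧ classOf S = d.1) d.2.1)
    (hX : ∀ d ∈ data, d.2.2.F = o.F ∧ M.Refines N o d.2.2 ∧ d.2.2.Eliminated d.2.1 n₀ ∧
      ∀ e ∈ d.2.2.coeffs, e.ell.Prime ∧ e.ell ≠ 2 ∧ ¬ e.ell ∣ N) :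
    M.Excludes N o fam := by
  intro S hS f hfo harises
  obtain ⟨-, d, hd, hdκ⟩ := hfam S hS
  obtain ⟨hF, hRef, helim, hgood⟩ := hX d hd
  have hsub : M.Excludes N o (fun S' => fam S' ∧ classOf S' = d.1) :=
    M.excludes_of_refinedTraces o d.2.2 hF hRef _ n₀ d.2.1 (hRT d hd) (fun S' hS' => (hfam S' hS'.1).1) helim hgood
  exact hsub S ⟨hS, hdκ.symm⟩ f hfo harises

end Summit.Ventures.AbcSig
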